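import Summits.BirchSwinnertonDyer.BirchSwinnertonDyer.Theorems.QuadraticBranchSignedControlPlusEtaNonsurjConjADoorBSDRankOneCoeff
import Summits.BirchSwinnertonDyer.BirchSwinnertonDyer.Theorems.QuadraticBranchSignedControlPlusEtaNonsurjConjADoorRecordsPrimeLA
import Summits.BirchSwinnertonDyer.Rank1Residual.X11b.ChaPairsMinimality
import Summits.BirchSwinnertonDyer.Rank1Residual.X11b.KrausMinimalityGeneralTwo
import HarnessLib

/-!
# Route `QuadraticBranchSignedControl` (rung K8, cell `bsd-potss`), residual crux `PlusEtaMainConjectureNonsurj`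
# (stmt-BirchSwinnertonDyer-19606): IN-TABLE `BSD_5` RECORDS R1N(s) — `MissingPPartAt W 5` on `λ⁻ = 1` CM CornerF rank-one rows of the K8 table that pass
# door L6 (`5 ∤ h(ℚ(P))`), modulo named published facts and DISPLAYED NUMERICS ONLY (seat `bsd-potss-k8eta-c2` g22; kit j332613)

WHAT. g20's door census (QP5) found 56 in-table prime-`L` rank-one rows (`ε = −1`, `λ⁺ = 1`, `μ⁺ = 0`, Cremona rank 1) with `5 ∤ h(ℚ(P))` (door L6,
GRH); its generic `EtaConjADoorRecords.etaMC_r1_of_classNumber` gives (C1⁺_η)@5 on each by name, and this seat's rank-one assembly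
(`EtaConjADoorBSDRankOne`, p718742) Miller's `BSDp W 5` modulo the crux instance C-cc-1@row. Kit j332613 (twin `ellpadiclambdamu(V,5,1,2)` + g19's
etacomp; P-22I registered before the result) supplies per row the minus-`η` `(λ⁻, μ⁻)`, the `5`-divisibility level `ν` of a generator, `#Ш_an`, `Tam`,
`#tors`; on the rows with `(λ⁻, μ⁻) = (1, 0)`, `ν = 0`, `v₅(#Ш_an·Tam/#tors²) = 0` the crux instance follows from these numerics (N1)–(N3) by
`EtaConjADoorBSDRankOne.minusLeadingValuationAt_zero_of_unit_coeff_of_indivisible` (p724126). Rows of this part: 6075c1 (CM, `h(ℚ(P)) = 2`, Tam = 2, #tors = 1, #Ш_an = 1), 6400f1 (CM, `h(ℚ(P)) = 1`, Tam = 4, #tors = 2, #Ш_an = 1), 81675bw1 (CM, `h(ℚ(P)) = 3`, Tam = 6, #tors = 1, #Ш_an = 1). Kernel per curve: `Δ ≠ 0`,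
global minimality (Kraus/Silverman support certificate, `decide`).

HONEST FRAMING (cell `bsd-potss`; FULL-BSD rank ≤ 1 programme, HUMAN RULING D-0036/D-0074): per-row RECORDS, CONDITIONAL on the named facts `hGZK hmod hnf
hM h12 hKO hGZ h74 h22 h41 h6273` and displayed per-row data (GRH class number, PARI `λ^±, μ^±`, `ellrank` generator + `5`-divisibility, `#Ш_an`, `Tam`,
`#tors`, the twin `V` with its tower clause); numerics are evidence, not kernel facts; `BSD(W,5)` ASSERTED for no pair; C-cc-1 NOT proved; no stub of
19606 proved; crux and route OPEN; nothing booked. `--supports stmt-BirchSwinnertonDyer-19606`.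

References: [Kobayashi2003] Thm. 1.2, 2.2, §4, Thm. 4.1, 6.2–7.4, 9.3; [Kobayashi2013]; [KitajimaOtsuki2018] Main Thm. 1.3; [GrossZagier1986] I (7.3);
[Mazur1978] Cor. 4.1; [Miller2011LMS] Def. 1.1; [CoatesSujatha2005] §3 (A); [SilvermanAEC2009] VII.1 Rem. 1.1; [Cremona1997] Table 1.
-/

set_option autoImplicit false
set_option linter.dupNamespace false
noncomputable section

open scoped Classical nonZeroDivisors

open CongruenceSubgroup NumberField Field WeierstrassCurve
open Literature.NumberTheory.EllipticCurves Literature.NumberTheory.EllipticCurves.ModularForms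
  Literature.NumberTheory.EllipticCurves.Rank1Residual Literature.NumberTheory.EllipticCurves.Rank1Residual.Typed
  Literature.NumberTheory.GaloisRepresentations Literature.NumberTheory.GaloisCohomology Literature.NumberTheory.NumberFields
  Literature.NumberTheory.EllipticCurves.GreenbergVatsal2000 ZpExtension
open Summit.BirchSwinnertonDyer.Rank1Residual Summit.BirchSwinnertonDyer.Rank1Residual.Additive
open Summit.BirchSwinnertonDyer.Rank1Residual.X11b (isElliptic_of_discOf_ne_zero)
open Summit.BirchSwinnertonDyer.BirchSwinnertonDyer.Theorems
open Summit.BirchSwinnertonDyer.Rank1Residual.X11b (isElliptic_of_discOf_ne_zero isGloballyMinimal_of_krausCriterion_support)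

namespace Summit.BirchSwinnertonDyer.BirchSwinnertonDyer.Theorems.EtaConjADoorBSDRecordsR1

/-- The K8 table row `W = [0, 0, 1, 0, 281]` (Cremona label 6075c1, CM, `N_W = 6075`, additive at `5`): `Δ ≠ 0` (kernel). [cite: Cremona1997, Table
1] -/
theorem isElliptic_6075c1 : (⟨0, 0, 1, 0, 281⟩ : WeierstrassCurve ℚ).IsElliptic :=
  isElliptic_of_discOf_ne_zero 0 0 1 0 281 (by decide +kernel)

set_option maxRecDepth 100000 in
/-- `W = [0, 0, 1, 0, 281]` is a global minimal equation (Silverman VII.1 Rem. 1.1 on the support `|Δ| = 3^7 · 5^6` — at every prime `q` of the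
support `q¹² ∤ Δ` or `q⁴ ∤ c₄`, or Kraus's test at `2`; tree `isGloballyMinimal_of_krausCriterion_support`, kernel `decide`). [cite:
SilvermanAEC2009, VII.1 Remark 1.1] [cite: Kraus1989, Prop. 1 and Prop. 2] -/
theorem isGloballyMinimal_6075c1 : (⟨0, 0, 1, 0, 281⟩ : WeierstrassCurve ℚ).IsGloballyMinimal :=
  isGloballyMinimal_of_krausCriterion_support 0 0 1 0 281 [(3, 0, 7), (5, 0, 6)]
    (by
      intro t ht
      simp only [List.mem_cons, List.not_mem_nil, or_false] at ht
      rcases ht with rfl | rfl <;> norm_num)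
    (by decide +kernel) (by decide +kernel)

/-- **`MissingPPartAt W 5` — `ord_5 #Ш(W) = ord_5 #Ш_an(W)` (from Miller's `BSDp W 5`) — for the CM CornerF in-table prime-`L` rank-one partner
6075c1, granted ONE good `a_5 = 0` globally minimal model `V` of `W^{(5)}` with non-onto `5`-adic tower, modulo named facts and DISPLAYED NUMERICS
ONLY (no conjecture instance: the `λ⁻ = 1` shape)** (`W = [0, 0, 1, 0, 281]`, CM, `N_W = 6075`; kit QP5 (k8eta-c2 g20) / j326603 (g21) + j332613
(twin λ±/μ±, etacomp) (GRH): `ε(W) = −1`, PARI plus-`η` `(λ, μ) = (1, 0)`, `r_an(W) = 1` (`Cremona rank 1; k8eta-c2 g19/g20 census`); `h(ℚ(P)) = 2`,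
`h(ℚ(x(P))) = 2`; eigen dimensions `(d₁,d₂,d₃,d₄) = (0,0,0,0)` — door L6 (`5 ∤ h(ℚ(P))`) passes) from the ROW ALONE — named facts `hGZK hmod hnf hM
h12 hKO hGZ h74 h22 h41 h6273` (GZK, modularity, newforms, Mazur `p ∤ c₀`, Kobayashi Thm. 1.2 / 2.2 / 4.1 / 6.2–7.4, Kitajima–Otsuki Thm. 1.3,
Gross–Zagier I (7.3); Poitou–Tate and the layer comparison are tree theorems); displayed: `r_an(W) = 1`, the twin `V` with the tower clause,
`(L_5⁺(V,η,X)) = (X)`, and — INSTEAD of the crux C-cc-1 at the row — three NUMERICAL data that make its `δ = 0` law trivially true here: (N1) every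
period-normalised minus branch function `L_5⁻(V,η,X)` has a UNIT `X`-coefficient (PARI minus-`η` `(λ, μ) = (1, 0)`), (N2) no generator of
`W(ℚ)/tors` is `5`-divisible in `W(ℚ_5)` (kit: `ν = 0`), (N3) `v_5(q·Tam/#tors²) = 0` for `q = #Ш_an(W)` (kit: `#Ш_an = 1`, `Tam = 2`, `#tors = 1`),
the class-group datum. Instance of `EtaConjADoorBSDRankOne.bsdp_of_plusEtaMainConjectureAt_of_analyticRank_eq_one` ∘ g20's
`EtaConjADoorRecords.etaMC_r1_of_classNumber` with `hcc1 :=` `minusLeadingValuationAt_zero_of_unit_coeff_of_indivisible` (k8eta-c2 g22).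
CONDITIONAL; nothing booked. [cite: Kobayashi2003, §4 (p. 8), Thm. 2.2 (p. 5)] [cite: CoatesSujatha2005, §3 (A) and Thm. 3.4] [cite: Cremona1997,
Table 1] -/
theorem missingPPartAt_r1n_6075c1_5_of_classNumber
    (hGZK : rank_eq_analyticRank_of_analyticRank_le_one) (hmod : hasEntireLFunction_rat)
    (hnf : exists_isNewformOf) (hM : mazur_not_dvd_maninConstant_of_odd)
    (h12 : Kobayashi2003.thm12_signedSelmerDual_finite_torsion)
    (hKO : KitajimaOtsuki2018.mainThm13_etaSignedSelmerDual_noFiniteSubmodule)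
    (hGZ : GrossZagier1986_thm_I_7_3) (h74 : Kobayashi2003.thm74_etaEvenMC_iff_etaOddMC)
    (h22 : Kobayashi2003.thm22_etaSignedSelmerDual_finite_torsion)
    (h41 : Kobayashi2003.thm41_plusEtaCharIdeal_dvd)
    (h6273 : Kobayashi2003.thm62_63_73_etaColemanPoitouTate) [Fact (5 : ℕ).Prime]
    (W : WeierstrassCurve ℚ) (hW : W = (⟨0, 0, 1, 0, 281⟩ : WeierstrassCurve ℚ)) (hr : W.analyticRank = 1)
    (V : WeierstrassCurve ℚ) [V.IsElliptic] [V.IsGloballyMinimal] (C : VariableChange ℚ)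
    (hC : C • W.quadraticTwist 5 = V)
    (hgood : V.HasGoodReductionAtPrime 5) (hap : V.frobeniusTrace 5 = 0)
    (hns : ¬ ∀ m : ℕ, V.HasSurjectiveModNGaloisRep (5 ^ m : ℕ))
    (hX : ∀ {N : ℕ} [NeZero N] {f : CuspForm (Gamma0 N) 2}, IsNewformOf V f →
      ∀ (ϖ : ℚ), (if Even (5 / 2) then (ϖ : ℝ) * V.realPeriodRat = plusPeriod f
          else (ϖ : ℝ) * V.imaginaryPeriodRat = minusPeriod f) →
      ∀ (Lη : IwasawaAlgebra 5), IsQuadraticBranchPlusLFunction f 5 ϖ Lη →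
        Ideal.span {Lη} = Ideal.span {(PowerSeries.X : IwasawaAlgebra 5)})
    (hP : haveI : W.IsElliptic := hW ▸ isElliptic_6075c1
      haveI : NeZero (5 : ℕ) := ⟨by norm_num⟩
      haveI : NumberField (W.divisionField 5) := NumberField.mk
      ∃ P : geomTorsion W ((5 : ℕ) : ℤ), P ≠ 0 ∧
        ¬ 5 ∣ NumberField.classNumber (IntermediateField.fixedField
          ((MulAction.stabilizer (absoluteGaloisGroup ℚ) P).map (absRestrictNormalHom (W.divisionField 5)))))
    (hcoef : haveI : W.IsElliptic := hW ▸ isElliptic_6075c1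
      ∀ (V' : WeierstrassCurve ℚ) [V'.IsElliptic] [V'.IsGloballyMinimal] (C' : VariableChange ℚ)
        {N : ℕ} [NeZero N] {f : CuspForm (Gamma0 N) 2},
        C' • W.quadraticTwist 5 = V' → V'.HasGoodReductionAtPrime 5 → V'.frobeniusTrace 5 = 0 → IsNewformOf V' f →
        ∀ (ϖ : ℚ), (if Even (5 / 2) then (ϖ : ℝ) * V'.realPeriodRat = plusPeriod f
            else (ϖ : ℝ) * V'.imaginaryPeriodRat = minusPeriod f) →
        ∀ (L : IwasawaAlgebra 5), IsQuadraticBranchMinusLFunction f 5 ϖ L → IsUnit (PowerSeries.coeff 1 L))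
    (hnd : haveI : W.IsElliptic := hW ▸ isElliptic_6075c1
      ∀ P : W.toAffine.Point, ¬ IsOfFinAddOrder P →
        (∀ R : W.toAffine.Point, ∃ (k : ℤ) (T : W.toAffine.Point), IsOfFinAddOrder T ∧ R = k • P + T) →
        ∀ Q : (W.baseChange ℚ_[5]).toAffine.Point, 5 • Q ≠ W.toPadicPoint 5 P)
    (hval : haveI : W.IsElliptic := hW ▸ isElliptic_6075c1
      haveI : W.IsGloballyMinimal := hW ▸ isGloballyMinimal_6075c1
      ∀ q : ℚ, shaAn W = (q : ℂ) → padicValRat 5 (q * W.tamagawaProduct / (W.torsionOrder : ℚ) ^ 2) = 0) :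
    MissingPPartAt W 5 := by
  rw [← show ((-1 : ℚ) ^ ((5 : ℕ) / 2) * ((5 : ℕ) : ℚ)) = (5 : ℚ) by norm_num] at hcoef
  subst hW
  haveI : (⟨0, 0, 1, 0, 281⟩ : WeierstrassCurve ℚ).IsElliptic := isElliptic_6075c1
  haveI : (⟨0, 0, 1, 0, 281⟩ : WeierstrassCurve ℚ).IsGloballyMinimal := isGloballyMinimal_6075c1
  haveI : NeZero (5 : ℕ) := ⟨by norm_num⟩
  haveI : Finite (⟨0, 0, 1, 0, 281⟩ : WeierstrassCurve ℚ).sha := (hGZK _ (by omega)).2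
  exact missingPPartAt_of_bsdp _ 5 (EtaConjADoorBSDRankOne.bsdp_of_plusEtaMainConjectureAt_of_analyticRank_eq_one _ 5 hGZK hmod hnf hM h12 hKO hGZ h74 (le_refl 5) V C
      (by rw [show ((-1 : ℚ) ^ ((5 : ℕ) / 2) * ((5 : ℕ) : ℚ)) = 5 by norm_num]; exact hC) hgood hap
      (EtaConjADoorRecords.etaMC_r1_of_classNumber h22 h41 h6273 hGZK 5 (le_refl 5) _ hr V C
        (by rw [show ((-1 : ℚ) ^ ((5 : ℕ) / 2) * ((5 : ℕ) : ℚ)) = 5 by norm_num]; exact hC) hgood hap hns hX hP) hr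
    (EtaConjADoorBSDRankOne.minusLeadingValuationAt_zero_of_unit_coeff_of_indivisible _ 5 hcoef hnd hval))

/-- The K8 table row `W = [0, -1, 0, -83, 287]` (Cremona label 6400f1, CM, `N_W = 6400`, additive at `5`): `Δ ≠ 0` (kernel). [cite: Cremona1997,
Table 1] -/
theorem isElliptic_6400f1 : (⟨0, (-1), 0, (-83), 287⟩ : WeierstrassCurve ℚ).IsElliptic :=
  isElliptic_of_discOf_ne_zero 0 (-1) 0 (-83) 287 (by decide +kernel)

set_option maxRecDepth 100000 in
/-- `W = [0, -1, 0, -83, 287]` is a global minimal equation (Silverman VII.1 Rem. 1.1 on the support `|Δ| = 2^9 · 5^6` — at every prime `q` of the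
support `q¹² ∤ Δ` or `q⁴ ∤ c₄`, or Kraus's test at `2`; tree `isGloballyMinimal_of_krausCriterion_support`, kernel `decide`). [cite:
SilvermanAEC2009, VII.1 Remark 1.1] [cite: Kraus1989, Prop. 1 and Prop. 2] -/
theorem isGloballyMinimal_6400f1 : (⟨0, (-1), 0, (-83), 287⟩ : WeierstrassCurve ℚ).IsGloballyMinimal :=
  isGloballyMinimal_of_krausCriterion_support 0 (-1) 0 (-83) 287 [(2, 0, 9), (5, 0, 6)]
    (by
      intro t ht
      simp only [List.mem_cons, List.not_mem_nil, or_false] at ht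
      rcases ht with rfl | rfl <;> norm_num)
    (by decide +kernel) (by decide +kernel)

/-- **`MissingPPartAt W 5` — `ord_5 #Ш(W) = ord_5 #Ш_an(W)` (from Miller's `BSDp W 5`) — for the CM CornerF in-table prime-`L` rank-one partner
6400f1, granted ONE good `a_5 = 0` globally minimal model `V` of `W^{(5)}` with non-onto `5`-adic tower, modulo named facts and DISPLAYED NUMERICS
ONLY (no conjecture instance: the `λ⁻ = 1` shape)** (`W = [0, -1, 0, -83, 287]`, CM, `N_W = 6400`; kit QP5 (k8eta-c2 g20) / j326603 (g21) + j332613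
(twin λ±/μ±, etacomp) (GRH): `ε(W) = −1`, PARI plus-`η` `(λ, μ) = (1, 0)`, `r_an(W) = 1` (`Cremona rank 1; k8eta-c2 g19/g20 census`); `h(ℚ(P)) = 1`,
`h(ℚ(x(P))) = 1`; eigen dimensions `(d₁,d₂,d₃,d₄) = (0,0,0,0)` — door L6 (`5 ∤ h(ℚ(P))`) passes) from the ROW ALONE — named facts `hGZK hmod hnf hM
h12 hKO hGZ h74 h22 h41 h6273` (GZK, modularity, newforms, Mazur `p ∤ c₀`, Kobayashi Thm. 1.2 / 2.2 / 4.1 / 6.2–7.4, Kitajima–Otsuki Thm. 1.3,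
Gross–Zagier I (7.3); Poitou–Tate and the layer comparison are tree theorems); displayed: `r_an(W) = 1`, the twin `V` with the tower clause,
`(L_5⁺(V,η,X)) = (X)`, and — INSTEAD of the crux C-cc-1 at the row — three NUMERICAL data that make its `δ = 0` law trivially true here: (N1) every
period-normalised minus branch function `L_5⁻(V,η,X)` has a UNIT `X`-coefficient (PARI minus-`η` `(λ, μ) = (1, 0)`), (N2) no generator of
`W(ℚ)/tors` is `5`-divisible in `W(ℚ_5)` (kit: `ν = 0`), (N3) `v_5(q·Tam/#tors²) = 0` for `q = #Ш_an(W)` (kit: `#Ш_an = 1`, `Tam = 4`, `#tors = 2`),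
the class-group datum. Instance of `EtaConjADoorBSDRankOne.bsdp_of_plusEtaMainConjectureAt_of_analyticRank_eq_one` ∘ g20's
`EtaConjADoorRecords.etaMC_r1_of_classNumber` with `hcc1 :=` `minusLeadingValuationAt_zero_of_unit_coeff_of_indivisible` (k8eta-c2 g22).
CONDITIONAL; nothing booked. [cite: Kobayashi2003, §4 (p. 8), Thm. 2.2 (p. 5)] [cite: CoatesSujatha2005, §3 (A) and Thm. 3.4] [cite: Cremona1997,
Table 1] -/
theorem missingPPartAt_r1n_6400f1_5_of_classNumber
    (hGZK : rank_eq_analyticRank_of_analyticRank_le_one) (hmod : hasEntireLFunction_rat)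
    (hnf : exists_isNewformOf) (hM : mazur_not_dvd_maninConstant_of_odd)
    (h12 : Kobayashi2003.thm12_signedSelmerDual_finite_torsion)
    (hKO : KitajimaOtsuki2018.mainThm13_etaSignedSelmerDual_noFiniteSubmodule)
    (hGZ : GrossZagier1986_thm_I_7_3) (h74 : Kobayashi2003.thm74_etaEvenMC_iff_etaOddMC)
    (h22 : Kobayashi2003.thm22_etaSignedSelmerDual_finite_torsion)
    (h41 : Kobayashi2003.thm41_plusEtaCharIdeal_dvd)
    (h6273 : Kobayashi2003.thm62_63_73_etaColemanPoitouTate) [Fact (5 : ℕ).Prime]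
    (W : WeierstrassCurve ℚ) (hW : W = (⟨0, (-1), 0, (-83), 287⟩ : WeierstrassCurve ℚ)) (hr : W.analyticRank = 1)
    (V : WeierstrassCurve ℚ) [V.IsElliptic] [V.IsGloballyMinimal] (C : VariableChange ℚ)
    (hC : C • W.quadraticTwist 5 = V)
    (hgood : V.HasGoodReductionAtPrime 5) (hap : V.frobeniusTrace 5 = 0)
    (hns : ¬ ∀ m : ℕ, V.HasSurjectiveModNGaloisRep (5 ^ m : ℕ))
    (hX : ∀ {N : ℕ} [NeZero N] {f : CuspForm (Gamma0 N) 2}, IsNewformOf V f →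
      ∀ (ϖ : ℚ), (if Even (5 / 2) then (ϖ : ℝ) * V.realPeriodRat = plusPeriod f
          else (ϖ : ℝ) * V.imaginaryPeriodRat = minusPeriod f) →
      ∀ (Lη : IwasawaAlgebra 5), IsQuadraticBranchPlusLFunction f 5 ϖ Lη →
        Ideal.span {Lη} = Ideal.span {(PowerSeries.X : IwasawaAlgebra 5)})
    (hP : haveI : W.IsElliptic := hW ▸ isElliptic_6400f1
      haveI : NeZero (5 : ℕ) := ⟨by norm_num⟩
      haveI : NumberField (W.divisionField 5) := NumberField.mk
      ∃ P : geomTorsion W ((5 : ℕ) : ℤ), P ≠ 0 ∧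
        ¬ 5 ∣ NumberField.classNumber (IntermediateField.fixedField
          ((MulAction.stabilizer (absoluteGaloisGroup ℚ) P).map (absRestrictNormalHom (W.divisionField 5)))))
    (hcoef : haveI : W.IsElliptic := hW ▸ isElliptic_6400f1
      ∀ (V' : WeierstrassCurve ℚ) [V'.IsElliptic] [V'.IsGloballyMinimal] (C' : VariableChange ℚ)
        {N : ℕ} [NeZero N] {f : CuspForm (Gamma0 N) 2},
        C' • W.quadraticTwist 5 = V' → V'.HasGoodReductionAtPrime 5 → V'.frobeniusTrace 5 = 0 → IsNewformOf V' f →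
        ∀ (ϖ : ℚ), (if Even (5 / 2) then (ϖ : ℝ) * V'.realPeriodRat = plusPeriod f
            else (ϖ : ℝ) * V'.imaginaryPeriodRat = minusPeriod f) →
        ∀ (L : IwasawaAlgebra 5), IsQuadraticBranchMinusLFunction f 5 ϖ L → IsUnit (PowerSeries.coeff 1 L))
    (hnd : haveI : W.IsElliptic := hW ▸ isElliptic_6400f1
      ∀ P : W.toAffine.Point, ¬ IsOfFinAddOrder P →
        (∀ R : W.toAffine.Point, ∃ (k : ℤ) (T : W.toAffine.Point), IsOfFinAddOrder T ∧ R = k • P + T) →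
        ∀ Q : (W.baseChange ℚ_[5]).toAffine.Point, 5 • Q ≠ W.toPadicPoint 5 P)
    (hval : haveI : W.IsElliptic := hW ▸ isElliptic_6400f1
      haveI : W.IsGloballyMinimal := hW ▸ isGloballyMinimal_6400f1
      ∀ q : ℚ, shaAn W = (q : ℂ) → padicValRat 5 (q * W.tamagawaProduct / (W.torsionOrder : ℚ) ^ 2) = 0) :
    MissingPPartAt W 5 := by
  rw [← show ((-1 : ℚ) ^ ((5 : ℕ) / 2) * ((5 : ℕ) : ℚ)) = (5 : ℚ) by norm_num] at hcoef
  subst hW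
  haveI : (⟨0, (-1), 0, (-83), 287⟩ : WeierstrassCurve ℚ).IsElliptic := isElliptic_6400f1
  haveI : (⟨0, (-1), 0, (-83), 287⟩ : WeierstrassCurve ℚ).IsGloballyMinimal := isGloballyMinimal_6400f1
  haveI : NeZero (5 : ℕ) := ⟨by norm_num⟩
  haveI : Finite (⟨0, (-1), 0, (-83), 287⟩ : WeierstrassCurve ℚ).sha := (hGZK _ (by omega)).2
  exact missingPPartAt_of_bsdp _ 5 (EtaConjADoorBSDRankOne.bsdp_of_plusEtaMainConjectureAt_of_analyticRank_eq_one _ 5 hGZK hmod hnf hM h12 hKO hGZ h74 (le_refl 5) V C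
      (by rw [show ((-1 : ℚ) ^ ((5 : ℕ) / 2) * ((5 : ℕ) : ℚ)) = 5 by norm_num]; exact hC) hgood hap
      (EtaConjADoorRecords.etaMC_r1_of_classNumber h22 h41 h6273 hGZK 5 (le_refl 5) _ hr V C
        (by rw [show ((-1 : ℚ) ^ ((5 : ℕ) / 2) * ((5 : ℕ) : ℚ)) = 5 by norm_num]; exact hC) hgood hap hns hX hP) hr
    (EtaConjADoorBSDRankOne.minusLeadingValuationAt_zero_of_unit_coeff_of_indivisible _ 5 hcoef hnd hval))

/-- The K8 table row `W = [0, 0, 1, 0, 457531]` (Cremona label 81675bw1, CM, `N_W = 81675`, additive at `5`): `Δ ≠ 0` (kernel). [cite: Cremona1997,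
Table 1] -/
theorem isElliptic_81675bw1 : (⟨0, 0, 1, 0, 457531⟩ : WeierstrassCurve ℚ).IsElliptic :=
  isElliptic_of_discOf_ne_zero 0 0 1 0 457531 (by decide +kernel)

set_option maxRecDepth 100000 in
/-- `W = [0, 0, 1, 0, 457531]` is a global minimal equation (Silverman VII.1 Rem. 1.1 on the support `|Δ| = 3^3 · 5^6 · 11^8` — at every prime `q`
of the support `q¹² ∤ Δ` or `q⁴ ∤ c₄`, or Kraus's test at `2`; tree `isGloballyMinimal_of_krausCriterion_support`, kernel `decide`). [cite:
SilvermanAEC2009, VII.1 Remark 1.1] [cite: Kraus1989, Prop. 1 and Prop. 2] -/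
theorem isGloballyMinimal_81675bw1 : (⟨0, 0, 1, 0, 457531⟩ : WeierstrassCurve ℚ).IsGloballyMinimal :=
  isGloballyMinimal_of_krausCriterion_support 0 0 1 0 457531 [(3, 0, 3), (5, 0, 6), (11, 0, 8)]
    (by
      intro t ht
      simp only [List.mem_cons, List.not_mem_nil, or_false] at ht
      rcases ht with rfl | rfl | rfl <;> norm_num)
    (by decide +kernel) (by decide +kernel)

/-- **`MissingPPartAt W 5` — `ord_5 #Ш(W) = ord_5 #Ш_an(W)` (from Miller's `BSDp W 5`) — for the CM CornerF in-table prime-`L` rank-one partner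
81675bw1, granted ONE good `a_5 = 0` globally minimal model `V` of `W^{(5)}` with non-onto `5`-adic tower, modulo named facts and DISPLAYED NUMERICS
ONLY (no conjecture instance: the `λ⁻ = 1` shape)** (`W = [0, 0, 1, 0, 457531]`, CM, `N_W = 81675`; kit QP5 (k8eta-c2 g20) / j326603 (g21) + j332613
(twin λ±/μ±, etacomp) (GRH): `ε(W) = −1`, PARI plus-`η` `(λ, μ) = (1, 0)`, `r_an(W) = 1` (`Cremona rank 1; k8eta-c2 g19/g20 census`); `h(ℚ(P)) = 3`,
`h(ℚ(x(P))) = 3`; eigen dimensions `(d₁,d₂,d₃,d₄) = (0,0,0,0)` — door L6 (`5 ∤ h(ℚ(P))`) passes) from the ROW ALONE — named facts `hGZK hmod hnf hM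
h12 hKO hGZ h74 h22 h41 h6273` (GZK, modularity, newforms, Mazur `p ∤ c₀`, Kobayashi Thm. 1.2 / 2.2 / 4.1 / 6.2–7.4, Kitajima–Otsuki Thm. 1.3,
Gross–Zagier I (7.3); Poitou–Tate and the layer comparison are tree theorems); displayed: `r_an(W) = 1`, the twin `V` with the tower clause,
`(L_5⁺(V,η,X)) = (X)`, and — INSTEAD of the crux C-cc-1 at the row — three NUMERICAL data that make its `δ = 0` law trivially true here: (N1) every
period-normalised minus branch function `L_5⁻(V,η,X)` has a UNIT `X`-coefficient (PARI minus-`η` `(λ, μ) = (1, 0)`), (N2) no generator of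
`W(ℚ)/tors` is `5`-divisible in `W(ℚ_5)` (kit: `ν = 0`), (N3) `v_5(q·Tam/#tors²) = 0` for `q = #Ш_an(W)` (kit: `#Ш_an = 1`, `Tam = 6`, `#tors = 1`),
the class-group datum. Instance of `EtaConjADoorBSDRankOne.bsdp_of_plusEtaMainConjectureAt_of_analyticRank_eq_one` ∘ g20's
`EtaConjADoorRecords.etaMC_r1_of_classNumber` with `hcc1 :=` `minusLeadingValuationAt_zero_of_unit_coeff_of_indivisible` (k8eta-c2 g22).
CONDITIONAL; nothing booked. [cite: Kobayashi2003, §4 (p. 8), Thm. 2.2 (p. 5)] [cite: CoatesSujatha2005, §3 (A) and Thm. 3.4] [cite: Cremona1997,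
Table 1] -/
theorem missingPPartAt_r1n_81675bw1_5_of_classNumber
    (hGZK : rank_eq_analyticRank_of_analyticRank_le_one) (hmod : hasEntireLFunction_rat)
    (hnf : exists_isNewformOf) (hM : mazur_not_dvd_maninConstant_of_odd)
    (h12 : Kobayashi2003.thm12_signedSelmerDual_finite_torsion)
    (hKO : KitajimaOtsuki2018.mainThm13_etaSignedSelmerDual_noFiniteSubmodule)
    (hGZ : GrossZagier1986_thm_I_7_3) (h74 : Kobayashi2003.thm74_etaEvenMC_iff_etaOddMC)
    (h22 : Kobayashi2003.thm22_etaSignedSelmerDual_finite_torsion)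
    (h41 : Kobayashi2003.thm41_plusEtaCharIdeal_dvd)
    (h6273 : Kobayashi2003.thm62_63_73_etaColemanPoitouTate) [Fact (5 : ℕ).Prime]
    (W : WeierstrassCurve ℚ) (hW : W = (⟨0, 0, 1, 0, 457531⟩ : WeierstrassCurve ℚ)) (hr : W.analyticRank = 1)
    (V : WeierstrassCurve ℚ) [V.IsElliptic] [V.IsGloballyMinimal] (C : VariableChange ℚ)
    (hC : C • W.quadraticTwist 5 = V)
    (hgood : V.HasGoodReductionAtPrime 5) (hap : V.frobeniusTrace 5 = 0)
    (hns : ¬ ∀ m : ℕ, V.HasSurjectiveModNGaloisRep (5 ^ m : ℕ))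
    (hX : ∀ {N : ℕ} [NeZero N] {f : CuspForm (Gamma0 N) 2}, IsNewformOf V f →
      ∀ (ϖ : ℚ), (if Even (5 / 2) then (ϖ : ℝ) * V.realPeriodRat = plusPeriod f
          else (ϖ : ℝ) * V.imaginaryPeriodRat = minusPeriod f) →
      ∀ (Lη : IwasawaAlgebra 5), IsQuadraticBranchPlusLFunction f 5 ϖ Lη →
        Ideal.span {Lη} = Ideal.span {(PowerSeries.X : IwasawaAlgebra 5)})
    (hP : haveI : W.IsElliptic := hW ▸ isElliptic_81675bw1
      haveI : NeZero (5 : ℕ) := ⟨by norm_num⟩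
      haveI : NumberField (W.divisionField 5) := NumberField.mk
      ∃ P : geomTorsion W ((5 : ℕ) : ℤ), P ≠ 0 ∧
        ¬ 5 ∣ NumberField.classNumber (IntermediateField.fixedField
          ((MulAction.stabilizer (absoluteGaloisGroup ℚ) P).map (absRestrictNormalHom (W.divisionField 5)))))
    (hcoef : haveI : W.IsElliptic := hW ▸ isElliptic_81675bw1
      ∀ (V' : WeierstrassCurve ℚ) [V'.IsElliptic] [V'.IsGloballyMinimal] (C' : VariableChange ℚ)
        {N : ℕ} [NeZero N] {f : CuspForm (Gamma0 N) 2},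
        C' • W.quadraticTwist 5 = V' → V'.HasGoodReductionAtPrime 5 → V'.frobeniusTrace 5 = 0 → IsNewformOf V' f →
        ∀ (ϖ : ℚ), (if Even (5 / 2) then (ϖ : ℝ) * V'.realPeriodRat = plusPeriod f
            else (ϖ : ℝ) * V'.imaginaryPeriodRat = minusPeriod f) →
        ∀ (L : IwasawaAlgebra 5), IsQuadraticBranchMinusLFunction f 5 ϖ L → IsUnit (PowerSeries.coeff 1 L))
    (hnd : haveI : W.IsElliptic := hW ▸ isElliptic_81675bw1
      ∀ P : W.toAffine.Point, ¬ IsOfFinAddOrder P →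
        (∀ R : W.toAffine.Point, ∃ (k : ℤ) (T : W.toAffine.Point), IsOfFinAddOrder T ∧ R = k • P + T) →
        ∀ Q : (W.baseChange ℚ_[5]).toAffine.Point, 5 • Q ≠ W.toPadicPoint 5 P)
    (hval : haveI : W.IsElliptic := hW ▸ isElliptic_81675bw1
      haveI : W.IsGloballyMinimal := hW ▸ isGloballyMinimal_81675bw1
      ∀ q : ℚ, shaAn W = (q : ℂ) → padicValRat 5 (q * W.tamagawaProduct / (W.torsionOrder : ℚ) ^ 2) = 0) :
    MissingPPartAt W 5 := by
  rw [← show ((-1 : ℚ) ^ ((5 : ℕ) / 2) * ((5 : ℕ) : ℚ)) = (5 : ℚ) by norm_num] at hcoef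
  subst hW
  haveI : (⟨0, 0, 1, 0, 457531⟩ : WeierstrassCurve ℚ).IsElliptic := isElliptic_81675bw1
  haveI : (⟨0, 0, 1, 0, 457531⟩ : WeierstrassCurve ℚ).IsGloballyMinimal := isGloballyMinimal_81675bw1
  haveI : NeZero (5 : ℕ) := ⟨by norm_num⟩
  haveI : Finite (⟨0, 0, 1, 0, 457531⟩ : WeierstrassCurve ℚ).sha := (hGZK _ (by omega)).2
  exact missingPPartAt_of_bsdp _ 5 (EtaConjADoorBSDRankOne.bsdp_of_plusEtaMainConjectureAt_of_analyticRank_eq_one _ 5 hGZK hmod hnf hM h12 hKO hGZ h74 (le_refl 5) V C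
      (by rw [show ((-1 : ℚ) ^ ((5 : ℕ) / 2) * ((5 : ℕ) : ℚ)) = 5 by norm_num]; exact hC) hgood hap
      (EtaConjADoorRecords.etaMC_r1_of_classNumber h22 h41 h6273 hGZK 5 (le_refl 5) _ hr V C
        (by rw [show ((-1 : ℚ) ^ ((5 : ℕ) / 2) * ((5 : ℕ) : ℚ)) = 5 by norm_num]; exact hC) hgood hap hns hX hP) hr
    (EtaConjADoorBSDRankOne.minusLeadingValuationAt_zero_of_unit_coeff_of_indivisible _ 5 hcoef hnd hval))

end Summit.BirchSwinnertonDyer.BirchSwinnertonDyer.Theorems.EtaConjADoorBSDRecordsR1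

end
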